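/-
Copyright: rh-split cell (dbn column, prover seat l19-w2) gen 0, 2026-08-27.  LINE 3 «two-ray Laguerre
squeeze» of ideator rh-idea-2 (D-0145).  The linear-factor ray is an RH-STRENGTHENING conjunct; this is a
CONDITIONAL certificate GIVEN the ray.  Nothing here bears on the truth of RH.
-/
import Summits.RiemannHypothesis.RiemannHypothesis.Theorems.Splittings.LinearRaySwing
import Summits.RiemannHypothesis.RiemannHypothesis.Theses.DBN
import HarnessLib

/-!
# Route `DBN` — item `LinearRaySwingLemma` PROVED (the route decl by name)

`LinearRaySwingLemma`: for every `a > 0`, GIVEN the ray `HasOnlyRealZeros (linearFactorH a)`, between two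
consecutive simple real zeros `x₁ < x₂` of `H_0` with `a (x₂ − x₁) ≤ 1` the two-sided factor
`F_a = deBruijnHDiv (1 + u²/a²)` is squeezed somewhere: `∃ y ∈ [x₁, x₂], |Re F_a(y)| ≤ a (x₂ − x₁) |Re H_0(y)|`.
The substance is `Splittings.LinearRaySwing.linearRaySwingLemma` (the abstract swing lemma
`Splittings.LinearRaySwingCore.exists_abs_le_of_swing` fed with the one-point sign rules of
`Splittings.LinearRayZeroSigns` and the tree ODE `deBruijnHDiv_laplace_sub_deriv_deriv`); this file only
restates it as the route decl.

Support item of LINE 3 (with `DBN.TypicalGapSqueezeSupply` it yields `DBN.LinearRayLargeA`); the ray is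
RH-strengthening (`LinearRayTwoPoint.riemannHypothesis_of_linearRay`), so this is conditional bookkeeping on
the negative side of the ladder.  RH is not proved by this; nothing here bears on the truth of RH.  No `sorry`,
no new axioms, no instances, no notation, no definitions.
-/

set_option linter.dupNamespace false  -- the mandated namespace repeats `RiemannHypothesis`

namespace Summit.RiemannHypothesis.RiemannHypothesis.Theorems.Splittings.LinearRaySwing

/-- **Item `LinearRaySwingLemma` of route `DBN` (stmt-RiemannHypothesis-22393) — PROVED** (the route decl by
name, from `linearRaySwingLemma`). -/
theorem linearRaySwingLemma_proof :
    Summit.RiemannHypothesis.RiemannHypothesis.Theses.DBN.LinearRaySwingLemma :=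
  fun _ ha hRay _ _ hx haδ hx₁ hx₂ hd₁ hd₂ hgap ↦ linearRaySwingLemma ha hRay hx haδ hx₁ hx₂ hd₁ hd₂ hgap

end Summit.RiemannHypothesis.RiemannHypothesis.Theorems.Splittings.LinearRaySwing
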